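import Summits.QuantumFields.YangMills.Theorems.IR.AfPincerUcTypClusterReduced
import Summits.QuantumFields.YangMills.Theorems.IR.Negative.ClauseIITypChainDeepFalseOfDeepGroundStateChains
import HarnessLib

/-!
# Crux `IR` (stmt-QuantumFields-19354), line `af-pincer-Uc-sharp` — NEGATIVE-SIDE CALIBRATION of the cluster-COUNT class `TypCluster`:
# disprove-1's ground-state engine READ IN COUNT CURRENCY — clustered ground states kill clause (ii) for `TypCluster` (and the count class's
# kernel sparseness) at a fixed frame; every chain kill is a count kill (seat ym-19354-afpincer-s1 g5)

Negative-side bookkeeping for item `stmt-QuantumFields-19354` (`--supports`; closes no stub; verdict of record NOT-REFUTED unchanged; slot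
«sharp merge I♯_SC» `Cruxes/IR/Lines/af_pincer_Uc_sharp.lean` sha16 `28967a1bf60ad397` UNTOUCHED).  Companion of this seat's positive files
`AfPincerUcTypCluster{,Peierls,Reduced}` (p570237 ∕ p571139 ∕ p572120: the count class, its Peierls engine, (iii) proved, (ii) reduced, suppliers,
free re-cut `TypChainReducedAtSC → TypClusterReducedAtSC`), written so that the refuter's (ii)-side attack has the same typed entry points for
the count class as disprove-1 GEN 11's `Negative/ClauseIITypChainFalseOfGroundStateChains` (p557336) gives for `TypChain` and S1 g4's
`Negative/ClauseIITypChainDeepFalseOfDeepGroundStateChains` (p563594) for `TypChainDeep`.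

* §1 the continuous CLUSTER DETECTOR: `clusterSupports w c k` (the finitely many plaquette sets of the cell carrying a cluster walk shape),
  `hasBadClusterAmong_iff_exists_support`, `clusterFree ρ θ m w k c` (`= 1` on `TypCluster ρ θ w k c`, `= 0` on configurations carrying a
  `(θ + m)`-bad cluster of more than `k` own plaquettes; continuous for continuous `ρ`) — GEN 11's `softBad`/`chainFree` pattern verbatim.
* §2 HYPOTHESIS `GroundStatesClustered ρ θ m w k c ζ` (zero temperature, finite-dimensional; asserted for no datum): at exterior `ζ` EVERY ground
  state of the cell's interior energy carries a `(θ + m)`-bad cluster of more than `k` own plaquettes.  **`groundStatesClustered_of_chained`**: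
  GEN 11's `GroundStatesChained ρ θ m w ℓ₀ c ζ` IMPLIES it for `2k ≤ ℓ₀ + 1` — EVERY CHAIN KILL IS A COUNT KILL (the count class is the smaller class;
  `hasBadClusterAmong_of_hasBadChainAmong`), in particular the LEAD's edge-chain forcing numerics (FORCING-NUMERICS-g3/g4) bear on the count
  class verbatim.  `countGuard_of_forall_lt`: an exterior without `θ`-bad plaquettes on the neighbour cells meets the COUNT guard
  (`mem_typCluster_of_forall_lt`) — the uniform sub-threshold flux exteriors of the numerics are admitted by the count guard too.
* §3 **`not_clauseIIukp_typCluster_of_groundStatesClustered`** (¬(ii) for `TypCluster ρ θ w k` at a fixed frame from clustered ground states under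
  a count-guard-clean exterior, every budget `0 ≤ δ < 1`, `F = F' = {c}`; `β₀` from compactness — FIXED MESH), **`not_kernelPlaqSparseCluster_of_groundStatesForce`**
  (one forced own plaquette kills `KernelPlaqSparseCluster` for every base `q < 1`), `mass_compl_typCluster_gt_half_of_groundStatesClustered`
  (the per-frame conjunct of a would-be count wire).

READING.  The count re-cut moves NOTHING on the (ii)-side: `TypCluster θ k ⊆ TypChain θ (2k−1)`, so a clustered (a fortiori chained) ground state
under a clean exterior kills the count class's (ii) exactly as it kills `TypChain`'s — the supplier's `θ` must sit above the forcing level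
(LEAD/S1 numerics, SU(2): `θ_force ≈ 0.36`; screened for `θ ≳ 0.5`), as before.  What the re-cut buys is on the (i)-side only (part 1
`not_mem_typCluster_of_injective`, part 3 `lineConfig_not_mem_typCluster`: walls read at every scale by count).  A mesh-uniform count wire and its
supplier calibration are left to the refuter lineage (shape: GEN 11's `FluxEdgeChainWire` with `TypChain ↦ TypCluster`).  Nothing here refutes
`TypClusterSharpSC`, `OnsetSharpUKPcSC` or `IR`.  HONEST FRAMING: negative bookkeeping around ONE open stub of a CONDITIONAL chain (Track A 0/28
UV); not a mass gap; not Clay.  No `sorry`; axioms ⊆ {propext, Classical.choice, Quot.sound}; no instances, no notation.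
-/

set_option autoImplicit false

noncomputable section

open MeasureTheory Filter Topology
open Literature.MathematicalPhysics.QuantumFieldTheory hiding ZdEdge
open Literature.MathematicalPhysics.QuantumLattice
open Literature.Probability.LatticeModels
open Summit.QuantumFields.YangMills.Cruxes.IR.Tempered (cellEdges regionEdges)
open Summit.QuantumFields.YangMills.Theorems.OddTorusChessboard (cellPlaqs plaqAction plaqAction_congr measurable_plaqAction)

namespace Summit.QuantumFields.YangMills.Cruxes.IR.AfPincerUc.SharpLanes.GroundStateForcing

open Summit.QuantumFields.YangMills.Cruxes.IR.AfPincerUc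
open Summit.QuantumFields.YangMills.Cruxes.IR.AfPincerUc.SharpLanes

/-! ## §1 A continuous cluster detector -/
section Detector

variable {G : Type} [Group G] {N : ℕ} (ρ : G →* Matrix (Fin N) (Fin N) ℂ)

open Classical in
/-- The possible SUPPORTS of a bad cluster of more than `k` plaquettes in the cell `c`: the plaquette sets `R ⊆ cellPlaqs w c` that carry a
cluster walk shape (a walk of `≤ 2k` steps of `ℓ∞`-length `≤ 2` inside `R` visiting `≥ k + 1` distinct plaquettes) — a finite family. -/
def clusterSupports (w : Fin 4 → ℤ → ℤ) (c : Fin 4 → ℤ) (k : ℕ) : Finset (Finset (ZdPlaquette 4)) :=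
  (cellPlaqs w c).powerset.filter fun R => ∃ (n : ℕ) (ch : Fin (n + 1) → ZdPlaquette 4), n ≤ 2 * k ∧ (∀ i, ch i ∈ R) ∧
    (∀ i : Fin n, supNormZ4 ((ch i.castSucc).1 - (ch i.succ).1) ≤ 2) ∧ k + 1 ≤ (Finset.univ.image ch).card

/-- A `θ`-bad cluster of more than `k` plaquettes among the cell's plaquettes EXISTS iff some cluster support is entirely `θ`-bad. -/
theorem hasBadClusterAmong_iff_exists_support (θ : ℝ) (w : Fin 4 → ℤ → ℤ) (c : Fin 4 → ℤ) (k : ℕ) (U : LGConfig 4 G) :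
    HasBadClusterAmong ρ θ (↑(cellPlaqs w c) : Set (ZdPlaquette 4)) k U ↔
      ∃ R ∈ clusterSupports w c k, ∀ p ∈ R, θ ≤ plaqAction ρ p U := by
  classical
  constructor
  · rintro ⟨n, ch, hn, hin, hbad, hstep, hcard⟩
    refine ⟨Finset.univ.image ch, ?_, ?_⟩
    · refine Finset.mem_filter.2 ⟨Finset.mem_powerset.2 ?_, n, ch, hn, fun i => Finset.mem_image_of_mem ch (Finset.mem_univ i),
        hstep, hcard⟩
      intro p hp
      obtain ⟨i, -, rfl⟩ := Finset.mem_image.1 hp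
      exact Finset.mem_coe.1 (hin i)
    · intro p hp
      obtain ⟨i, -, rfl⟩ := Finset.mem_image.1 hp
      exact hbad i
  · rintro ⟨R, hR, hall⟩
    obtain ⟨hRsub, n, ch, hn, hchR, hstep, hcard⟩ := Finset.mem_filter.1 hR
    exact ⟨n, ch, hn, fun i => Finset.mem_coe.2 (Finset.mem_powerset.1 hRsub (hchR i)), fun i => hall _ (hchR i), hstep, hcard⟩

/-- **The cluster detector** `g_{θ,m,k}(U) = ∏_{R} (1 − ∏_{p ∈ R} softBad_{θ,m}(p, U))` over the cluster supports `R` of the cell: a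
continuous `[0, 1]`-valued function, `= 1` on `TypCluster ρ θ w k c` and `= 0` on configurations carrying a `(θ + m)`-bad cluster of more
than `k` plaquettes in the cell. -/
def clusterFree (θ m : ℝ) (w : Fin 4 → ℤ → ℤ) (k : ℕ) (c : Fin 4 → ℤ) (U : LGConfig 4 G) : ℝ :=
  ∏ R ∈ clusterSupports w c k, (1 - ∏ p ∈ R, softBad ρ θ m p U)

/-- The cluster detector is nonnegative. -/
theorem clusterFree_nonneg (θ m : ℝ) (w : Fin 4 → ℤ → ℤ) (k : ℕ) (c : Fin 4 → ℤ) (U : LGConfig 4 G) :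
    0 ≤ clusterFree ρ θ m w k c U :=
  Finset.prod_nonneg fun R _ => by linarith [(prod_softBad_mem_Icc ρ θ m R U).2]

/-- On the count class the detector reads `1`: every cluster support contains a plaquette of action `< θ`. -/
theorem clusterFree_eq_one_of_mem_typCluster {θ m : ℝ} (hm : 0 < m) {w : Fin 4 → ℤ → ℤ} {k : ℕ} {c : Fin 4 → ℤ}
    {U : LGConfig 4 G} (hU : U ∈ TypCluster ρ θ w k c) : clusterFree ρ θ m w k c U = 1 := by
  refine Finset.prod_eq_one fun R hR => ?_
  have hex : ∃ p ∈ R, plaqAction ρ p U < θ := by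
    by_contra h
    push Not at h
    exact hU ((hasBadClusterAmong_iff_exists_support ρ θ w c k U).2 ⟨R, hR, h⟩)
  obtain ⟨p, hp, hlt⟩ := hex
  rw [Finset.prod_eq_zero hp (softBad_eq_zero_of_lt ρ hm hlt), sub_zero]

/-- On a configuration carrying a `(θ + m)`-bad cluster of more than `k` plaquettes in the cell the detector reads `0`. -/
theorem clusterFree_eq_zero_of_cluster {θ m : ℝ} (hm : 0 < m) {w : Fin 4 → ℤ → ℤ} {k : ℕ} {c : Fin 4 → ℤ}
    {U : LGConfig 4 G} (hU : HasBadClusterAmong ρ (θ + m) (↑(cellPlaqs w c) : Set (ZdPlaquette 4)) k U) :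
    clusterFree ρ θ m w k c U = 0 := by
  obtain ⟨R, hR, hall⟩ := (hasBadClusterAmong_iff_exists_support ρ (θ + m) w c k U).1 hU
  refine Finset.prod_eq_zero hR ?_
  rw [Finset.prod_eq_one fun p hp => softBad_eq_one_of_le ρ hm (hall p hp), sub_self]

variable [TopologicalSpace G] [IsTopologicalGroup G]

/-- Continuity of the cluster detector (continuous `ρ`). -/
theorem continuous_clusterFree (hρ : Continuous ρ) (θ m : ℝ) (w : Fin 4 → ℤ → ℤ) (k : ℕ) (c : Fin 4 → ℤ) :
    Continuous (clusterFree (G := G) ρ θ m w k c) := by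
  unfold clusterFree
  exact continuous_finsetProd _ fun R _ => continuous_const.sub (continuous_finsetProd _ fun p _ => continuous_softBad ρ hρ θ m p)

end Detector

/-! ## §2 The hypothesis «ground states are clustered»; every chain kill is a count kill -/
section Hypothesis

variable {G : Type} [Group G] {N : ℕ} (ρ : G →* Matrix (Fin N) (Fin N) ℂ)

/-- **HYPOTHESIS «ground states are clustered» (zero temperature, finite-dimensional; asserted for no datum).**  At exterior `ζ`, EVERY ground
state of the interior energy of the cell `c` of the frame `w` (region `regionEdges w {c}`, all other links frozen to `ζ`) carries a
`(θ + m)`-bad cluster of MORE THAN `k` own plaquettes (`HasBadClusterAmong`: a `(θ + m)`-bad walk of `≤ 2k` steps through `k + 1` distinct own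
plaquettes) — e.g. a forced edge chain of `k + 1` plaquettes (the LEAD's/S1's cooling numerics at `θ ≲ 0.36`, SU(2)). -/
def GroundStatesClustered (θ m : ℝ) (w : Fin 4 → ℤ → ℤ) (k : ℕ) (c : Fin 4 → ℤ) (ζ : LGConfig 4 G) : Prop :=
  ∀ x : ↥(regionEdges w {c}) → G, IsGroundState ρ (regionEdges w {c}) ζ x →
    HasBadClusterAmong ρ (θ + m) (↑(cellPlaqs w c) : Set (ZdPlaquette 4)) k (glueWith (regionEdges w {c}) x ζ)

variable {ρ}

/-- **EVERY CHAIN KILL IS A COUNT KILL (PROVED)**: GEN 11's `GroundStatesChained ρ θ m w ℓ₀ c ζ` implies `GroundStatesClustered ρ θ m w k c ζ` for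
`2k ≤ ℓ₀ + 1` (a long bad chain contains a bad cluster of more than `k` plaquettes, `hasBadClusterAmong_of_hasBadChainAmong`). -/
theorem groundStatesClustered_of_chained {θ m : ℝ} {w : Fin 4 → ℤ → ℤ} {k ℓ₀ : ℕ} (hkℓ : 2 * k ≤ ℓ₀ + 1) {c : Fin 4 → ℤ}
    {ζ : LGConfig 4 G} (h : GroundStatesChained ρ θ m w ℓ₀ c ζ) : GroundStatesClustered ρ θ m w k c ζ :=
  fun x hx => hasBadClusterAmong_of_hasBadChainAmong hkℓ (h x hx)

/-- **The COUNT guard is met by exteriors without `θ`-bad plaquettes on the neighbour cells (PROVED)** — e.g. the uniform sub-threshold flux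
exteriors of the forcing numerics (`mem_typCluster_of_forall_lt`); so every guard-clean chain-kill datum of GEN 11 is a count-kill datum. -/
theorem countGuard_of_forall_lt {θ : ℝ} {w : Fin 4 → ℤ → ℤ} (k : ℕ) {c : Fin 4 → ℤ} {ζ : LGConfig 4 G}
    (h : ∀ c' : Fin 4 → ℤ, c' ≠ c → (∀ i, |c' i - c i| ≤ 1) → ∀ p ∈ cellPlaqs w c', plaqAction ρ p ζ < θ) :
    ∀ c' : Fin 4 → ℤ, c' ≠ c → (∀ i, |c' i - c i| ≤ 1) → ζ ∈ TypCluster ρ θ w k c' :=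
  fun c' hc' hcc => mem_typCluster_of_forall_lt (h c' hc' hcc)

/-- The count guard implies the guard of record at every extent `ℓ₀` with `2k ≤ ℓ₀ + 1` (`typCluster_subset_typChain`); the converse fails. -/
theorem chainGuard_of_countGuard {θ : ℝ} {w : Fin 4 → ℤ → ℤ} {k ℓ₀ : ℕ} (hkℓ : 2 * k ≤ ℓ₀ + 1) {c : Fin 4 → ℤ} {ζ : LGConfig 4 G}
    (hguard : ∀ c' : Fin 4 → ℤ, c' ≠ c → (∀ i, |c' i - c i| ≤ 1) → ζ ∈ TypCluster ρ θ w k c') :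
    ∀ c' : Fin 4 → ℤ, c' ≠ c → (∀ i, |c' i - c i| ≤ 1) → ζ ∈ TypChain ρ θ w ℓ₀ c' :=
  fun c' hc' hcc => typCluster_subset_typChain w hkℓ c' (hguard c' hc' hcc)

end Hypothesis

/-! ## §3 Conjunct (ii) for `TypCluster` and the count class's kernel sparseness DIE at a fixed frame when ground states are clustered -/
section FixedFrame

variable {G : Type} [Group G] [TopologicalSpace G] [IsTopologicalGroup G] [CompactSpace G]
  [MeasurableSpace G] [BorelSpace G] [SecondCountableTopology G] {N : ℕ} (ρ : G →* Matrix (Fin N) (Fin N) ℂ)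

/-- **Clustered ground states empty the count class (PROVED; closed family of exteriors).**  If the ground states are clustered at every
exterior of the closed family `K`, then for every `s > 0`: `γ^β_{cell c}(ζ)(TypCluster ρ θ w k c) ≤ s` for all `β ≥ β₀` and all `ζ` in an OPEN
neighbourhood `O ⊇ K` (GEN 11's kernel Laplace engine `kernel_measure_le_of_groundStates` with the cluster detector). -/
theorem kernel_typCluster_le_of_groundStatesClustered (hρ : Continuous ρ) {θ m : ℝ} (hm : 0 < m) (w : Fin 4 → ℤ → ℤ) (k : ℕ)
    (c : Fin 4 → ℤ) {K : Set (LGConfig 4 G)} (hK : IsClosed K) (hGS : ∀ ζ ∈ K, GroundStatesClustered ρ θ m w k c ζ) {s : ℝ}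
    (hs : 0 < s) :
    ∃ O : Set (LGConfig 4 G), IsOpen O ∧ K ⊆ O ∧ ∃ β₀ : ℝ, ∀ β : ℝ, β₀ ≤ β → ∀ ζ ∈ O,
      (ymSpecification ρ β (regionEdges w {c}) ζ) (TypCluster ρ θ w k c) ≤ ENNReal.ofReal s :=
  kernel_measure_le_of_groundStates ρ hρ _ hK (measurableSet_typCluster ρ hρ θ w k c) (continuous_clusterFree ρ hρ θ m w k c)
    (fun _ hU => (clusterFree_eq_one_of_mem_typCluster ρ hm hU).ge) (clusterFree_nonneg ρ θ m w k c)
    (fun ζ hζ x hx => (clusterFree_eq_zero_of_cluster ρ hm (hGS ζ hζ x hx)).le) hs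

/-- **Clustered ground states empty the count class (PROVED; one exterior, no separation hypothesis on `G`):** the bound holds on an open
neighbourhood of the given exterior `ζ` (via the closed family `closure {ζ}`). -/
theorem kernel_typCluster_le_of_groundStatesClustered_at (hρ : Continuous ρ) {θ m : ℝ} (hm : 0 < m) (w : Fin 4 → ℤ → ℤ) (k : ℕ)
    (c : Fin 4 → ℤ) {ζ : LGConfig 4 G} (hGS : GroundStatesClustered ρ θ m w k c ζ) {s : ℝ} (hs : 0 < s) :
    ∃ O : Set (LGConfig 4 G), IsOpen O ∧ ζ ∈ O ∧ ∃ β₀ : ℝ, ∀ β : ℝ, β₀ ≤ β → ∀ ζ' ∈ O,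
      (ymSpecification ρ β (regionEdges w {c}) ζ') (TypCluster ρ θ w k c) ≤ ENNReal.ofReal s := by
  have hK : ∀ y ∈ closure ({ζ} : Set (LGConfig 4 G)), GroundStatesClustered ρ θ m w k c y := by
    intro y hy x hx
    have hx' : IsGroundState ρ (regionEdges w {c}) ζ x := (isGroundState_iff_of_mem_closure_singleton ρ hρ hy _ x).1 hx
    refine (hGS x hx').congr fun q _ => ?_
    exact (eq_of_mem_closure_singleton hy _
      (continuous_const.sub (continuous_plaquetteObs ρ hρ q.1 q.2.1.1 q.2.1.2) : Continuous (plaqAction (G := G) ρ q)) x).symm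
  obtain ⟨O, hO, hKO, β₀, h⟩ := kernel_typCluster_le_of_groundStatesClustered ρ hρ hm w k c isClosed_closure hK hs
  exact ⟨O, hO, hKO (subset_closure (Set.mem_singleton ζ)), β₀, h⟩

/-- **¬(ii) FOR THE COUNT CLASS AT A FIXED FRAME from clustered ground states under a count-guard-clean exterior (PROVED).**  If `ζ` is
count-typical on the `3⁴ − 1` cells around `c` (met e.g. by any exterior without `θ`-bad plaquettes there, `countGuard_of_forall_lt`) and the
ground states of the cell `c` at `ζ` are clustered, then for every budget `0 ≤ δ < 1` clause (ii) in UKP form FAILS for `TypCluster ρ θ w k` on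
the frame `w` at all large `β` (`F = F' = {c}`, exterior `ζ`; FIXED MESH: `β₀` from compactness). -/
theorem not_clauseIIukp_typCluster_of_groundStatesClustered (hρ : Continuous ρ) {θ m : ℝ} (hm : 0 < m) (w : Fin 4 → ℤ → ℤ) (k : ℕ)
    (c : Fin 4 → ℤ) {ζ : LGConfig 4 G} (hguard : ∀ c' : Fin 4 → ℤ, c' ≠ c → (∀ i, |c' i - c i| ≤ 1) → ζ ∈ TypCluster ρ θ w k c')
    (hGS : GroundStatesClustered ρ θ m w k c ζ) {δ : ℝ} (hδ0 : 0 ≤ δ) (hδ : δ < 1) :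
    ∃ β₀ : ℝ, ∀ β : ℝ, β₀ ≤ β → ¬ ClauseIIukp ρ β w δ (TypCluster ρ θ w k) := by
  obtain ⟨O, -, hζO, β₀, h⟩ :=
    kernel_typCluster_le_of_groundStatesClustered_at ρ hρ hm w k c hGS (s := (1 - δ) / 2) (by linarith)
  refine ⟨β₀, fun β hβ hII => ?_⟩
  haveI := isProbabilityMeasure_ymSpecification ρ hρ β (regionEdges w {c}) ζ
  have hle := hII {c} {c} (Finset.Subset.refl _) (Finset.singleton_nonempty c) ζ (GroundStateForcingDeep.guard_singleton hguard)
  have hset : {σ : LGConfig 4 G | ∀ c₁ ∈ ({c} : Finset (Fin 4 → ℤ)), σ ∉ TypCluster ρ θ w k c₁} = (TypCluster ρ θ w k c)ᶜ := by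
    ext σ; simp
  rw [hset, Finset.card_singleton, pow_one, prob_compl_eq_one_sub (measurableSet_typCluster ρ hρ θ w k c)] at hle
  have h1 : (1 : ENNReal) ≤ ENNReal.ofReal δ + ENNReal.ofReal ((1 - δ) / 2) :=
    (tsub_le_iff_right.1 hle).trans (add_le_add le_rfl (h β hβ ζ hζO))
  rw [← ENNReal.ofReal_add hδ0 (by linarith), ← ENNReal.ofReal_one] at h1
  have h2 := (ENNReal.ofReal_le_ofReal_iff (by linarith)).1 h1
  linarith

/-- **¬(ii) for the count class from CHAINED ground states (PROVED; GEN 11's hypothesis, count-guard-clean exterior, `2k ≤ ℓ₀ + 1`).** -/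
theorem not_clauseIIukp_typCluster_of_groundStatesChained (hρ : Continuous ρ) {θ m : ℝ} (hm : 0 < m) (w : Fin 4 → ℤ → ℤ)
    {k ℓ₀ : ℕ} (hkℓ : 2 * k ≤ ℓ₀ + 1) (c : Fin 4 → ℤ) {ζ : LGConfig 4 G}
    (hguard : ∀ c' : Fin 4 → ℤ, c' ≠ c → (∀ i, |c' i - c i| ≤ 1) → ζ ∈ TypCluster ρ θ w k c')
    (hGS : GroundStatesChained ρ θ m w ℓ₀ c ζ) {δ : ℝ} (hδ0 : 0 ≤ δ) (hδ : δ < 1) :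
    ∃ β₀ : ℝ, ∀ β : ℝ, β₀ ≤ β → ¬ ClauseIIukp ρ β w δ (TypCluster ρ θ w k) :=
  not_clauseIIukp_typCluster_of_groundStatesClustered ρ hρ hm w k c hguard (groundStatesClustered_of_chained hkℓ hGS) hδ0 hδ

/-- **¬(count-class kernel plaquette sparseness) AT A FIXED FRAME from ONE forced plaquette (PROVED).**  If the ground states of the cell `c`
at the count-guard-clean exterior `ζ` force the own plaquette `p ∈ cellPlaqs w c` to action `≥ θ + m` (GEN 11's `GroundStatesForce`), then
`KernelPlaqSparseCluster ρ β w θ k q` FAILS for every base `0 ≤ q < 1` at all large `β` (`F = F' = {c}`, `X = {p}`). -/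
theorem not_kernelPlaqSparseCluster_of_groundStatesForce (hρ : Continuous ρ) {θ m : ℝ} (hm : 0 < m) (w : Fin 4 → ℤ → ℤ)
    (k : ℕ) (c : Fin 4 → ℤ) {p : ZdPlaquette 4} (hp : p ∈ cellPlaqs w c) {ζ : LGConfig 4 G}
    (hguard : ∀ c' : Fin 4 → ℤ, c' ≠ c → (∀ i, |c' i - c i| ≤ 1) → ζ ∈ TypCluster ρ θ w k c')
    (hGS : GroundStatesForce ρ θ m w c p ζ) {q : ℝ} (hq0 : 0 ≤ q) (hq : q < 1) :
    ∃ β₀ : ℝ, ∀ β : ℝ, β₀ ≤ β → ¬ KernelPlaqSparseCluster ρ β w θ k q := by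
  obtain ⟨O, -, hζO, β₀, h⟩ := kernel_plaqClean_le_of_groundStatesForce_at ρ hρ hm w c p hGS (s := (1 - q) / 2) (by linarith)
  refine ⟨β₀, fun β hβ hK => ?_⟩
  haveI := isProbabilityMeasure_ymSpecification ρ hρ β (regionEdges w {c}) ζ
  have hle := hK {c} {c} (Finset.Subset.refl _) (Finset.singleton_nonempty c) ζ (GroundStateForcingDeep.guard_singleton hguard) {p}
    (by rw [Finset.singleton_biUnion]; exact Finset.singleton_subset_iff.2 hp)
  have hset : {σ : LGConfig 4 G | ∀ p₁ ∈ ({p} : Finset (ZdPlaquette 4)), θ ≤ plaqAction ρ p₁ σ} =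
      {σ : LGConfig 4 G | plaqAction ρ p σ < θ}ᶜ := by
    ext σ; simp [not_lt]
  rw [hset, Finset.card_singleton, pow_one,
    prob_compl_eq_one_sub (measurableSet_lt (measurable_plaqAction ρ hρ p) measurable_const)] at hle
  have h1 : (1 : ENNReal) ≤ ENNReal.ofReal q + ENNReal.ofReal ((1 - q) / 2) :=
    (tsub_le_iff_right.1 hle).trans (add_le_add le_rfl (h β hβ ζ hζO))
  rw [← ENNReal.ofReal_add hq0 (by linarith), ← ENNReal.ofReal_one] at h1
  have h2 := (ENNReal.ofReal_le_ofReal_iff (by linarith)).1 h1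
  linarith

/-- **Fixed-frame instances of a would-be count wire (PROVED):** clustered ground states of the cell `c` at `ζ` ⇒ kernel mass `> 1/2` on
`(TypCluster ρ θ w k c)ᶜ` for all large `β`, near `ζ` (the per-frame conjunct; mesh-uniformity NOT addressed). -/
theorem mass_compl_typCluster_gt_half_of_groundStatesClustered (hρ : Continuous ρ) {θ m : ℝ} (hm : 0 < m) (w : Fin 4 → ℤ → ℤ)
    (k : ℕ) (c : Fin 4 → ℤ) {ζ : LGConfig 4 G} (hGS : GroundStatesClustered ρ θ m w k c ζ) :
    ∃ O : Set (LGConfig 4 G), IsOpen O ∧ ζ ∈ O ∧ ∃ β₀ : ℝ, ∀ β : ℝ, β₀ ≤ β → ∀ ζ' ∈ O,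
      ENNReal.ofReal (1 / 2) < (ymSpecification ρ β (regionEdges w {c}) ζ') (TypCluster ρ θ w k c)ᶜ := by
  obtain ⟨O, hO, hζO, β₀, h⟩ :=
    kernel_typCluster_le_of_groundStatesClustered_at ρ hρ hm w k c hGS (s := 1 / 4) (by norm_num)
  refine ⟨O, hO, hζO, β₀, fun β hβ ζ' hζ' => ?_⟩
  haveI := isProbabilityMeasure_ymSpecification ρ hρ β (regionEdges w {c}) ζ'
  rw [prob_compl_eq_one_sub (measurableSet_typCluster ρ hρ θ w k c)]
  have h34 : ENNReal.ofReal (1 / 2) < 1 - ENNReal.ofReal (1 / 4) := by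
    rw [← ENNReal.ofReal_one, ← ENNReal.ofReal_sub _ (by norm_num : (0 : ℝ) ≤ 1 / 4)]
    exact (ENNReal.ofReal_lt_ofReal_iff (by norm_num)).2 (by norm_num)
  exact h34.trans_le (tsub_le_tsub_left (h β hβ ζ' hζ') _)

end FixedFrame

end Summit.QuantumFields.YangMills.Cruxes.IR.AfPincerUc.SharpLanes.GroundStateForcing

end
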